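/-
COR-CM (cell pub-hodgecm2, stage 2 of the Hodge ladder) — count-neutral KERNEL COMBINATORICS «split index-two descent, III: the residual circulations
are generated by the two-cycle faces and the square elements» (seat prover-pub-hodgecm2-b23-g46-0, binder prover b23, gen 46; claim «SPLIT INDEX-TWO»,
HOME/INBOX.md l.20957).  Theorems only, on top of `Census/IndexTwoSplitResidual` BY NAME; no `decide`, no certificate, no named fact, no `sorry`;
`Interfaces.lean` (C1), every E term, B01, `Transposition/*`, `PortJoin/*`, `D2Bridge/*` untouched.
HONEST FRAMING: `HC_CM` is NOT proved, here or anywhere in the tree; nothing here is a period, a count of record or a headline.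
T5: n/a-class (hypothesis binders: `c * c = 1`, `c ≠ 1`, `c` central, `c ∈ H`, `H.index = 2`, `x ∉ H`); checker: self.
-/
import Summits.HodgeConjecture.CorCM.Census.IndexTwoSplitResidual

/-!
# Split index-two descent, III: residual circulations = two-cycle faces + square elements

Setting of `Census/IndexTwoSplitDistance.lean` / `Census/IndexTwoSplitResidual.lean` (`c ≠ 1` a central involution, `H ∋ c` of index two,
`x ∉ H`; the splitting `x·x = 1` is NOT needed in this part).  The residual types are the DIAGONAL types `Θ = (a, a)` and the NEIGHBOUR types
`Θ = (a, a^{(t)})` — the vertices and arcs of the bidirected cube on the types of `(H, c)`.  Two kinds of bi-marginal-zero vectors live there: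

* the **TWO-CYCLE FACES** `gface Θ t (x·t)` at DIAGONAL types `Θ = (a,a)`: `[(a,a)] + [(a^{(t)},a^{(t)})] − [(a^{(t)},a)] − [(a,a^{(t)})]`
  (a mixed face flipping the same place of `H` in both coordinates);
* the **SQUARE ELEMENTS** `gface Ψ k (x·l) − gface Ψ l (x·k)` at a type `Ψ` of distance `2` with differing places `k ≠ l` (the difference of its two
  descending mixed faces; supported on four arcs and two diagonals of a square of the cube).

**THEOREM (`mem_span_twoCycle_sup_square`).**  Every vector with `marg₀ = marg₁ = 0` supported on types of distance `≤ 1` lies in the `ℤ`-span of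
the two-cycle faces and the square elements (the circulation space of the bidirected cube is generated by the two-cycles and the boundaries of
the square faces — `H₁` of the `2`-skeleton of the cube vanishes).  PROOF: part IIʼs `tracked_descent` relative to a base type `T₀` of `(H, c)`
and canonical deviations `κ a ∈ T₀ ∖ a`, potential `4(wt a + wt b) + 6·[up-arc] + 2·[non-canonical down-arc]` on `(a, b)`: an UP-arc
`(a, a^{(t)})` (`t ∈ T₀ ∩ a`) is cleared by the two-cycle face through it, a NON-CANONICAL down-arc `(a, a^{(l)})` (`l ∈ T₀ ∖ a` off the place
of `κ a`) by the square element at `(a, a^{(κ a)(l)})`; the remainder is supported on diagonals and canonical down-arcs and vanishes by part IIʼs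
`eq_zero_of_supported_canonical`.

CONSEQUENCE (part IV, `Census/IndexTwoSplitChecklist.lean`, with parts I–II and `Census/IndexTwoLifting`): for a split index-two extension the
Hodge lattice of `(G, c)` is generated modulo pairs by the lifts of an `H`-generating family, ONE distance-lowering mixed face per block of distance
`≥ 2`, the two-cycle faces and the square elements — the face census of `G = H ⋊ ⟨x⟩` is reduced to the orbit structure of the cube on the types of `H`.

## References
* [Pohlmann1968] H. Pohlmann, Algebraic cycles on abelian varieties of complex multiplication type, Ann. of Math. 88 (1968), Thm 1.
-/

namespace Summit.HodgeConjecture.CorCM.Census.IndexTwoDescent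

open Finset
open Summit.HodgeConjecture.CorCM.Prior.AllgGroup.RfwfAllgGroup
open Summit.HodgeConjecture.CorCM.Census.BlockParity
open Summit.HodgeConjecture.CorCM.Census.Coinvariant
open Summit.HodgeConjecture.CorCM.Census.ComplementFaces

noncomputable section

variable {G : Type*} [Group G] [Fintype G] [DecidableEq G] {c : G}
variable {H : Subgroup G} [DecidablePred (· ∈ H)]

/-! ## §1 Bookkeeping -/

omit [DecidablePred (· ∈ H)] in
/-- **A face read from an adjacent corner changes sign**: `gface (Φ^{(s')}) s s' = − gface Φ s s'`. [folklore] -/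
theorem gface_oflipCM_right (hc2 : c * c = 1) (Φ : CMF G c) (s s' : G) :
    gface c hc2 (oflipCM c hc2 s' Φ) s s' = - gface c hc2 Φ s s' := by
  unfold gface
  rw [oflipCM_oflipCM_self, oflipCM_oflipCM_comm c hc2 s s']
  abel

section K

variable {K : Type*} [Group K] [Fintype K] [DecidableEq K] (c' : K)

/-- `wt` of a type against itself is `0`. [folklore] -/
theorem wt_self (T : CMF K c') : wt c' T T = 0 := by
  unfold wt; rw [sdiff_self]; rfl

/-- A type and its single flip are at `wt`-distance `1` (either orientation, any element of the place). [folklore] -/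
theorem wt_oflipCM_eq_one (hc2' : c' * c' = 1) (T : CMF K c') (d : K) : wt c' (oflipCM c' hc2' d T) T = 1 := by
  rw [wt_comm c' hc2']
  by_cases hd : d ∈ T.1
  · exact wt_oflipCM_self c' hc2' hd
  · have hcd : c' * d ∈ T.1 := by by_contra h; exact hd ((T.2 d).mpr h)
    rw [← oflipCM_cmul c' hc2']
    exact wt_oflipCM_self c' hc2' hcd

/-- Flipping a type at a place adds one to its weight against a type containing neither... : if `d ∉ T` then `wt T (Ψ^{(d)})` for `d ∉ Ψ`
equals `wt T Ψ + 1` when `c·d ∈ T` — phrased through `c·d`. [folklore] -/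
theorem wt_oflipCM_of_notMem_notMem (hc2' : c' * c' = 1) {T Ψ : CMF K c'} {d : K} (hdT : d ∉ T.1) (hdΨ : d ∉ Ψ.1) :
    wt c' T (oflipCM c' hc2' d Ψ) = wt c' T Ψ + 1 := by
  have hcdT : c' * d ∈ T.1 := by by_contra h; exact hdT ((T.2 d).mpr h)
  have hcdΨ : c' * d ∈ Ψ.1 := by by_contra h; exact hdΨ ((Ψ.2 d).mpr h)
  rw [← oflipCM_cmul c' hc2']
  exact wt_oflipCM_of_mem c' hc2' hcdT hcdΨ

end K

/-! ## §2 The structure theorem -/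

/-- **RESIDUAL CIRCULATIONS = TWO-CYCLE FACES + SQUARE ELEMENTS.**  For every central involution `c ≠ 1`, every subgroup `H ∋ c` of index two and
every `x ∉ H`: a vector with `marg₀ = marg₁ = 0` supported on types of distance `≤ 1` lies in
`ℤ⟨gface Θ t (x·t) : res₁ Θ = res₀ Θ⟩ ⊔ ℤ⟨gface Ψ k (x·l) − gface Ψ l (x·k) : dist Ψ = 2, k ≠ l ∈ res₁ Ψ ∖ res₀ Ψ⟩`. [folklore] -/
theorem mem_span_twoCycle_sup_square (hcH : c ∈ H) (hcen : ∀ g : G, g * c = c * g) (hc2 : c * c = 1) (hc1 : c ≠ 1) (hH : H.index = 2)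
    {x : G} (hx : x ∉ H) {z : CMF G c →₀ ℤ} (hz0 : marg₀ hcH z = 0) (hz1 : marg₁ hcH hcen x z = 0)
    (hsupp : ∀ Θ ∈ z.support, wt (⟨c, hcH⟩ : H) (res₁ hcH hcen x Θ) (res₀ hcH Θ) ≤ 1) :
    z ∈ Submodule.span ℤ {y | ∃ (Θ : CMF G c) (t : H), res₁ hcH hcen x Θ = res₀ hcH Θ ∧ y = gface c hc2 Θ (t : G) (x * (t : G))} ⊔
      Submodule.span ℤ {y | ∃ (Ψ : CMF G c) (k l : H), wt (⟨c, hcH⟩ : H) (res₁ hcH hcen x Ψ) (res₀ hcH Ψ) = 2 ∧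
        k ∈ (res₁ hcH hcen x Ψ).1 ∧ k ∉ (res₀ hcH Ψ).1 ∧ l ∈ (res₁ hcH hcen x Ψ).1 ∧ l ∉ (res₀ hcH Ψ).1 ∧ k ≠ l ∧
        y = gface c hc2 Ψ (k : G) (x * (l : G)) - gface c hc2 Ψ (l : G) (x * (k : G))} := by
  classical
  have hc2' := csub_mul_csub hcH hc2
  -- base type and canonical deviations
  obtain ⟨Φ₀, hΦ₀⟩ := exists_isCMF (⟨c, hcH⟩ : H) hc2' (csub_ne_one hcH hc1)
  set T₀ : CMF H ⟨c, hcH⟩ := ⟨Φ₀, hΦ₀⟩ with hT₀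
  have hdev : ∀ a : CMF H ⟨c, hcH⟩, a ≠ T₀ → ∃ d : H, d ∈ T₀.1 ∧ d ∉ a.1 := by
    intro a ha
    have hne : (T₀.1 \ a.1).Nonempty := by
      rw [← Finset.card_pos]
      by_contra h
      exact ha (eq_of_wt_eq_zero (⟨c, hcH⟩ : H) (by unfold wt; omega))
    obtain ⟨d, hd⟩ := hne
    exact ⟨d, (mem_sdiff.mp hd).1, (mem_sdiff.mp hd).2⟩
  choose! κ hκT hκa using hdev
  -- potential, residue, kept support, target module
  set W : CMF H ⟨c, hcH⟩ → ℕ := fun a => wt (⟨c, hcH⟩ : H) T₀ a with hW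
  set P : CMF G c → ℕ := fun Θ => 4 * (W (res₀ hcH Θ) + W (res₁ hcH hcen x Θ)) +
    (if W (res₀ hcH Θ) < W (res₁ hcH hcen x Θ) then 6 else 0) +
    (if W (res₁ hcH hcen x Θ) < W (res₀ hcH Θ) ∧
        res₁ hcH hcen x Θ ≠ oflipCM (⟨c, hcH⟩ : H) hc2' (κ (res₀ hcH Θ)) (res₀ hcH Θ) then 2 else 0) with hP
  set Res : CMF G c → Prop := fun Θ => res₁ hcH hcen x Θ = res₀ hcH Θ ∨
    (res₀ hcH Θ ≠ T₀ ∧ res₁ hcH hcen x Θ = oflipCM (⟨c, hcH⟩ : H) hc2' (κ (res₀ hcH Θ)) (res₀ hcH Θ)) with hRes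
  set Keep : CMF G c → Prop := fun Θ => wt (⟨c, hcH⟩ : H) (res₁ hcH hcen x Θ) (res₀ hcH Θ) ≤ 1 with hKeep
  set L := Submodule.span ℤ {y | ∃ (Θ : CMF G c) (t : H), res₁ hcH hcen x Θ = res₀ hcH Θ ∧ y = gface c hc2 Θ (t : G) (x * (t : G))} ⊔
      Submodule.span ℤ {y | ∃ (Ψ : CMF G c) (k l : H), wt (⟨c, hcH⟩ : H) (res₁ hcH hcen x Ψ) (res₀ hcH Ψ) = 2 ∧
        k ∈ (res₁ hcH hcen x Ψ).1 ∧ k ∉ (res₀ hcH Ψ).1 ∧ l ∈ (res₁ hcH hcen x Ψ).1 ∧ l ∉ (res₀ hcH Ψ).1 ∧ k ≠ l ∧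
        y = gface c hc2 Ψ (k : G) (x * (l : G)) - gface c hc2 Ψ (l : G) (x * (k : G))} with hL
  -- THE RELATIONS
  have hrel : ∀ Θ : CMF G c, Keep Θ → ¬ Res Θ → ∃ v ∈ L, ∃ w : CMF G c →₀ ℤ,
      (∀ Φ : CMF G c, w Φ ≠ 0 → Keep Φ ∧ P Φ < P Θ) ∧ v = Finsupp.single Θ 1 + w := by
    intro Θ hK hR
    -- names
    set a := res₀ hcH Θ with ha
    set b := res₁ hcH hcen x Θ with hb
    have hKeep : wt (⟨c, hcH⟩ : H) b a ≤ 1 := hK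
    have hne : b ≠ a := fun h => hR (Or.inl h)
    have h1 : wt (⟨c, hcH⟩ : H) b a = 1 := by
      have h0 : wt (⟨c, hcH⟩ : H) b a ≠ 0 := fun h0 => hne (eq_of_wt_eq_zero _ h0).symm
      omega
    obtain ⟨d, hdb, hda⟩ := exists_eq_oflipCM_of_wt_eq_one _ hc2' h1
    have hba : b = oflipCM (⟨c, hcH⟩ : H) hc2' (d : H) a := by rw [hda, oflipCM_oflipCM_self]
    have hdna : d ∉ a.1 := by
      rw [hda]
      change d ∉ oflip (⟨c, hcH⟩ : H) d b.1
      rw [oflip, Finset.mem_symmDiff, mem_orb]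
      rintro (⟨-, h⟩ | ⟨-, h⟩)
      · exact h (Or.inl rfl)
      · exact h hdb
    -- corner restrictions of a mixed face `gface Θ' s (x s')` (for any Θ')
    have hc0 : ∀ (Θ' : CMF G c) (s : H), res₀ hcH (oflipCM c hc2 (s : G) Θ') = oflipCM (⟨c, hcH⟩ : H) hc2' s (res₀ hcH Θ') :=
      fun Θ' s => res₀_oflipCM_coe hcH hc2 s Θ'
    have hc1 : ∀ (Θ' : CMF G c) (s : H), res₁ hcH hcen x (oflipCM c hc2 (s : G) Θ') = res₁ hcH hcen x Θ' :=
      fun Θ' s => res₁_oflipCM_coe hcH hcen hc2 hx s Θ'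
    have hx0 : ∀ (Θ' : CMF G c) (s : H), res₀ hcH (oflipCM c hc2 (x * (s : G)) Θ') = res₀ hcH Θ' :=
      fun Θ' s => res₀_oflipCM_mul hcH hcen hc2 hx s Θ'
    have hx1 : ∀ (Θ' : CMF G c) (s : H), res₁ hcH hcen x (oflipCM c hc2 (x * (s : G)) Θ') =
        oflipCM (⟨c, hcH⟩ : H) hc2' s (res₁ hcH hcen x Θ') := fun Θ' s => res₁_oflipCM_mul hcH hcen hc2 x s Θ'
    -- potential of `Θ'` from its restrictions
    have hPval : ∀ Θ' : CMF G c, P Θ' = 4 * (W (res₀ hcH Θ') + W (res₁ hcH hcen x Θ')) +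
        (if W (res₀ hcH Θ') < W (res₁ hcH hcen x Θ') then 6 else 0) +
        (if W (res₁ hcH hcen x Θ') < W (res₀ hcH Θ') ∧
          res₁ hcH hcen x Θ' ≠ oflipCM (⟨c, hcH⟩ : H) hc2' (κ (res₀ hcH Θ')) (res₀ hcH Θ') then 2 else 0) := fun Θ' => rfl
    have hPle : ∀ Θ' : CMF G c, P Θ' ≤ 4 * (W (res₀ hcH Θ') + W (res₁ hcH hcen x Θ')) + 6 +
        (if W (res₁ hcH hcen x Θ') < W (res₀ hcH Θ') then 2 else 0) := by
      intro Θ'; rw [hPval]; split_ifs <;> omega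
    by_cases hdT : d ∈ T₀.1
    · ---------------- DOWN ARC: `d ∈ T₀ ∖ a`, `W b + 1 = W a`
      have hwb : W b + 1 = W a := by rw [hba]; exact wt_oflipCM_of_notMem _ hc2' hdT hdna
      have haT : a ≠ T₀ := by
        intro h
        have : W a = 0 := by rw [h]; exact wt_self _ T₀
        omega
      set k : H := κ a with hk
      have hkT : k ∈ T₀.1 := hκT a haT
      have hka : k ∉ a.1 := hκa a haT
      have hbk : b ≠ oflipCM (⟨c, hcH⟩ : H) hc2' k a := fun h => hR (Or.inr ⟨haT, h⟩)
      have hkd : k ≠ d := by rintro h; exact hbk (by rw [hba, h])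
      have hkcd : k ≠ ⟨c, hcH⟩ * d := fun h => ((T₀.2 d).mp hdT) (by rw [← h]; exact hkT)
      have hknb : k ∉ b.1 := by
        rw [hba]
        change k ∉ oflip (⟨c, hcH⟩ : H) d a.1
        rw [oflip, Finset.mem_symmDiff, mem_orb]
        rintro (⟨h, -⟩ | ⟨h, -⟩)
        · exact hka h
        · rcases h with h | h
          · exact hkd h
          · exact hkcd h
      have hdnk : d ∉ orb (⟨c, hcH⟩ : H) k := by
        rw [mem_orb]; rintro (h | h)
        · exact hkd h.symm
        · apply hkcd
          rw [h, ← mul_assoc, hc2', one_mul]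
      -- the far type and the square element
      set Ψ := oflipCM c hc2 (x * (k : G)) Θ with hΨ
      have hΨ0 : res₀ hcH Ψ = a := hx0 Θ k
      have hΨ1 : res₁ hcH hcen x Ψ = oflipCM (⟨c, hcH⟩ : H) hc2' k b := hx1 Θ k
      set b' := oflipCM (⟨c, hcH⟩ : H) hc2' k b with hb'
      set ak := oflipCM (⟨c, hcH⟩ : H) hc2' k a with hak
      have hwb' : W b' + 1 = W b := wt_oflipCM_of_notMem _ hc2' hkT hknb
      have hwak : W ak + 1 = W a := wt_oflipCM_of_notMem _ hc2' hkT hka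
      -- `wt b' a = 2`
      have hdist2 : wt (⟨c, hcH⟩ : H) b' a = 2 := by
        rw [hb', wt_comm _ hc2', wt_oflipCM_of_notMem_notMem _ hc2' hka hknb, wt_comm _ hc2', h1]
      -- memberships for the square set
      have hkb' : k ∈ b'.1 := by
        change k ∈ oflip (⟨c, hcH⟩ : H) k b.1
        rw [oflip, Finset.mem_symmDiff, mem_orb]; exact Or.inr ⟨Or.inl rfl, hknb⟩
      have hdb' : d ∈ b'.1 := by
        change d ∈ oflip (⟨c, hcH⟩ : H) k b.1
        rw [oflip, Finset.mem_symmDiff]; exact Or.inl ⟨hdb, hdnk⟩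
      have hvL : gface c hc2 Ψ (k : G) (x * (d : G)) - gface c hc2 Ψ (d : G) (x * (k : G)) ∈ L := by
        refine Submodule.mem_sup_right (Submodule.subset_span ⟨Ψ, k, d, ?_, ?_, ?_, ?_, ?_, hkd, rfl⟩)
        · rw [hΨ1, hΨ0]; exact hdist2
        · rw [hΨ1]; exact hkb'
        · rw [hΨ0]; exact hka
        · rw [hΨ1]; exact hdb'
        · rw [hΨ0]; exact hdna
      -- the five lower corners
      have hΘΨ : oflipCM c hc2 (x * (k : G)) Ψ = Θ := by rw [hΨ, oflipCM_oflipCM_self]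
      have hv : gface c hc2 Ψ (k : G) (x * (d : G)) - gface c hc2 Ψ (d : G) (x * (k : G)) =
          Finsupp.single Θ 1 + (Finsupp.single (oflipCM c hc2 (k : G) (oflipCM c hc2 (x * (d : G)) Ψ)) 1
            - Finsupp.single (oflipCM c hc2 (k : G) Ψ) 1 - Finsupp.single (oflipCM c hc2 (x * (d : G)) Ψ) 1
            - Finsupp.single (oflipCM c hc2 (d : G) (oflipCM c hc2 (x * (k : G)) Ψ)) 1 + Finsupp.single (oflipCM c hc2 (d : G) Ψ) 1) := by
        unfold gface
        rw [hΘΨ]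
        abel
      set Φ1 := oflipCM c hc2 (k : G) (oflipCM c hc2 (x * (d : G)) Ψ) with hΦ1
      set Φ2 := oflipCM c hc2 (k : G) Ψ with hΦ2
      set Φ3 := oflipCM c hc2 (x * (d : G)) Ψ with hΦ3
      set Φ4 := oflipCM c hc2 (d : G) (oflipCM c hc2 (x * (k : G)) Ψ) with hΦ4
      set Φ5 := oflipCM c hc2 (d : G) Ψ with hΦ5
      -- useful flip identities on `H`-types
      have hflip_db' : oflipCM (⟨c, hcH⟩ : H) hc2' d b' = ak := by
        rw [hb', hba, oflipCM_oflipCM_comm _ hc2' d k, oflipCM_oflipCM_self]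
      have hflip_da : oflipCM (⟨c, hcH⟩ : H) hc2' d a = b := hba.symm
      -- restrictions of the corners
      have r1 : res₀ hcH Φ1 = ak ∧ res₁ hcH hcen x Φ1 = ak := by
        rw [hΦ1, hc0, hc1, hx0, hx1, hΨ0, hΨ1, hflip_db']; exact ⟨rfl, rfl⟩
      have r2 : res₀ hcH Φ2 = ak ∧ res₁ hcH hcen x Φ2 = b' := by rw [hΦ2, hc0, hc1, hΨ0, hΨ1]; exact ⟨rfl, rfl⟩
      have r3 : res₀ hcH Φ3 = a ∧ res₁ hcH hcen x Φ3 = ak := by rw [hΦ3, hx0, hx1, hΨ0, hΨ1, hflip_db']; exact ⟨rfl, rfl⟩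
      have r4 : res₀ hcH Φ4 = b ∧ res₁ hcH hcen x Φ4 = b := by
        rw [hΦ4, hΘΨ, hc0, hc1, ← ha, ← hb, hflip_da]; exact ⟨rfl, rfl⟩
      have r5 : res₀ hcH Φ5 = b ∧ res₁ hcH hcen x Φ5 = b' := by rw [hΦ5, hc0, hc1, hΨ0, hΨ1, hflip_da]; exact ⟨rfl, rfl⟩
      -- potential of `Θ`
      have hPΘ : P Θ = 4 * (W a + W b) + 2 := by
        rw [hPval, ← ha, ← hb, if_neg (by omega), if_pos ⟨by omega, hbk⟩]
      refine ⟨_, hvL, Finsupp.single Φ1 1 - Finsupp.single Φ2 1 - Finsupp.single Φ3 1 - Finsupp.single Φ4 1 + Finsupp.single Φ5 1,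
        fun Φ hΦ => ?_, hv⟩
      · -- support of `w`
        have hcases : Φ = Φ1 ∨ Φ = Φ2 ∨ Φ = Φ3 ∨ Φ = Φ4 ∨ Φ = Φ5 := by
          by_contra hnot
          push Not at hnot
          obtain ⟨n1, n2, n3, n4, n5⟩ := hnot
          apply hΦ
          simp only [Finsupp.add_apply, Finsupp.sub_apply, Finsupp.single_apply, if_neg (Ne.symm n1), if_neg (Ne.symm n2),
            if_neg (Ne.symm n3), if_neg (Ne.symm n4), if_neg (Ne.symm n5)]
          norm_num
        rcases hcases with rfl | rfl | rfl | rfl | rfl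
        · refine ⟨?_, ?_⟩
          · show wt _ (res₁ hcH hcen x Φ1) (res₀ hcH Φ1) ≤ 1
            rw [r1.1, r1.2, wt_self]; omega
          · rw [hPΘ, hPval, r1.1, r1.2, if_neg (lt_irrefl _), if_neg (fun h => lt_irrefl _ h.1)]; omega
        · refine ⟨?_, ?_⟩
          · show wt _ (res₁ hcH hcen x Φ2) (res₀ hcH Φ2) ≤ 1
            rw [r2.1, r2.2, ← hflip_db', wt_comm _ hc2', wt_oflipCM_eq_one]
          · have := hPle Φ2; rw [r2.1, r2.2] at this; rw [hPΘ]; split_ifs at this <;> omega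
        · refine ⟨?_, ?_⟩
          · show wt _ (res₁ hcH hcen x Φ3) (res₀ hcH Φ3) ≤ 1
            rw [r3.1, r3.2, hak, wt_oflipCM_eq_one]
          · rw [hPΘ, hPval, r3.1, r3.2, if_neg (by omega), if_neg (fun h => h.2 (by rw [hak]))]
            omega
        · refine ⟨?_, ?_⟩
          · show wt _ (res₁ hcH hcen x Φ4) (res₀ hcH Φ4) ≤ 1
            rw [r4.1, r4.2, wt_self]; omega
          · rw [hPΘ, hPval, r4.1, r4.2, if_neg (lt_irrefl _), if_neg (fun h => lt_irrefl _ h.1)]; omega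
        · refine ⟨?_, ?_⟩
          · show wt _ (res₁ hcH hcen x Φ5) (res₀ hcH Φ5) ≤ 1
            rw [r5.1, r5.2, hb', wt_oflipCM_eq_one]
          · have := hPle Φ5; rw [r5.1, r5.2] at this; rw [hPΘ]; split_ifs at this <;> omega
    · ---------------- UP ARC: `d ∉ T₀`, so `c·d ∈ T₀ ∩ a` and `W b = W a + 1`
      have hcdT : ⟨c, hcH⟩ * d ∈ T₀.1 := by by_contra h; exact hdT ((T₀.2 d).mpr h)
      have hcda : ⟨c, hcH⟩ * d ∈ a.1 := by by_contra h; exact hdna ((a.2 d).mpr h)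
      have hwb : W b = W a + 1 := by
        rw [hba, ← oflipCM_cmul _ hc2' d a]; exact wt_oflipCM_of_mem _ hc2' hcdT hcda
      -- the two-cycle face through `Θ`, read at the diagonal corner `(a, a)`
      set Δ := oflipCM c hc2 (x * (d : G)) Θ with hΔ
      have hΔ0 : res₀ hcH Δ = a := hx0 Θ d
      have hΔ1 : res₁ hcH hcen x Δ = a := by rw [hΔ, hx1, ← hb, hba, oflipCM_oflipCM_self]
      have hvL : gface c hc2 Θ (d : G) (x * (d : G)) ∈ L := by
        have hq : gface c hc2 Δ (d : G) (x * (d : G)) ∈ L :=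
          Submodule.mem_sup_left (Submodule.subset_span ⟨Δ, d, by rw [hΔ1, hΔ0], rfl⟩)
        have he : gface c hc2 Θ (d : G) (x * (d : G)) = - gface c hc2 Δ (d : G) (x * (d : G)) := by
          rw [hΔ, gface_oflipCM_right, neg_neg]
        rw [he]; exact Submodule.neg_mem _ hq
      set Φ1 := oflipCM c hc2 (d : G) (oflipCM c hc2 (x * (d : G)) Θ) with hΦ1
      set Φ2 := oflipCM c hc2 (d : G) Θ with hΦ2
      have r1 : res₀ hcH Φ1 = b ∧ res₁ hcH hcen x Φ1 = a := by
        rw [hΦ1, hc0, hc1, hx0, hx1, ← ha, ← hb, ← hba, hba, oflipCM_oflipCM_self]; exact ⟨rfl, rfl⟩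
      have r2 : res₀ hcH Φ2 = b ∧ res₁ hcH hcen x Φ2 = b := by rw [hΦ2, hc0, hc1, ← ha, ← hb, ← hba]; exact ⟨rfl, rfl⟩
      have r3 : res₀ hcH Δ = a ∧ res₁ hcH hcen x Δ = a := ⟨hΔ0, hΔ1⟩
      have hPΘ : P Θ = 4 * (W a + W b) + 6 := by
        rw [hPval, ← ha, ← hb, if_pos (by omega), if_neg (fun h => by omega)]
      refine ⟨_, hvL, Finsupp.single Φ1 1 - Finsupp.single Φ2 1 - Finsupp.single Δ 1, fun Φ hΦ => ?_, by unfold gface; abel⟩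
      have hcases : Φ = Φ1 ∨ Φ = Φ2 ∨ Φ = Δ := by
        by_contra hnot
        push Not at hnot
        obtain ⟨n1, n2, n3⟩ := hnot
        apply hΦ
        simp only [Finsupp.sub_apply, Finsupp.single_apply, if_neg (Ne.symm n1), if_neg (Ne.symm n2), if_neg (Ne.symm n3)]
        norm_num
      rcases hcases with rfl | rfl | rfl
      · refine ⟨?_, ?_⟩
        · show wt _ (res₁ hcH hcen x Φ1) (res₀ hcH Φ1) ≤ 1
          rw [r1.1, r1.2, wt_comm _ hc2', h1]
        · rw [hPΘ, hPval, r1.1, r1.2, if_neg (by omega)]; split_ifs <;> omega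
      · refine ⟨?_, ?_⟩
        · show wt _ (res₁ hcH hcen x Φ2) (res₀ hcH Φ2) ≤ 1
          rw [r2.1, r2.2, wt_self]; omega
        · rw [hPΘ, hPval, r2.1, r2.2, if_neg (lt_irrefl _), if_neg (fun h => lt_irrefl _ h.1)]; omega
      · refine ⟨?_, ?_⟩
        · show wt _ (res₁ hcH hcen x Δ) (res₀ hcH Δ) ≤ 1
          rw [r3.1, r3.2, wt_self]; omega
        · rw [hPΘ, hPval, r3.1, r3.2, if_neg (lt_irrefl _), if_neg (fun h => lt_irrefl _ h.1)]; omega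
  -- THE DESCENT AND THE VANISHING LEMMA
  have hLZ : L ≤ LinearMap.ker (marg₀ hcH) ⊓ LinearMap.ker (marg₁ hcH hcen x) := by
    rw [hL]
    refine sup_le (Submodule.span_le.mpr ?_) (Submodule.span_le.mpr ?_)
    · rintro _ ⟨Θ, t, -, rfl⟩
      exact ⟨LinearMap.mem_ker.mpr (marg₀_gface_coe_mul hcH hcen hc2 hx Θ t t),
        LinearMap.mem_ker.mpr (marg₁_gface_coe_mul hcH hcen hc2 hx Θ t t)⟩
    · rintro _ ⟨Ψ, k, l, -, -, -, -, -, -, rfl⟩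
      exact Submodule.sub_mem _
        ⟨LinearMap.mem_ker.mpr (marg₀_gface_coe_mul hcH hcen hc2 hx Ψ k l), LinearMap.mem_ker.mpr (marg₁_gface_coe_mul hcH hcen hc2 hx Ψ k l)⟩
        ⟨LinearMap.mem_ker.mpr (marg₀_gface_coe_mul hcH hcen hc2 hx Ψ l k), LinearMap.mem_ker.mpr (marg₁_gface_coe_mul hcH hcen hc2 hx Ψ l k)⟩
  obtain ⟨z', hzz', hz'K, hz'R⟩ := tracked_descent P Res Keep L hrel z hsupp
  have hz'Z : z' ∈ LinearMap.ker (marg₀ hcH) ⊓ LinearMap.ker (marg₁ hcH hcen x) := by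
    have h : z' = z - (z - z') := by abel
    rw [h]
    exact Submodule.sub_mem _ ⟨LinearMap.mem_ker.mpr hz0, LinearMap.mem_ker.mpr hz1⟩ (hLZ hzz')
  have hz'0 : z' = 0 :=
    eq_zero_of_supported_canonical hcH hcen hc2 hH hx T₀ κ (fun a ha => ⟨hκT a ha, hκa a ha⟩)
      (LinearMap.mem_ker.mp hz'Z.1) (LinearMap.mem_ker.mp hz'Z.2) hz'R
  simpa [hz'0] using hzz'

end

end Summit.HodgeConjecture.CorCM.Census.IndexTwoDescent
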